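import Summits.HodgeConjecture.HodgeConjecture.Theorems.Ring2AbelianAllWeilSignCells
import Summits.HodgeConjecture.HodgeConjecture.Theorems.Ring2AbelianAllWeilDiscriminantDescent
import Literature.AlgebraicGeometry.Motives.HyperbolicWeilTypeProductModel
import Literature.AlgebraicGeometry.Motives.RationalDegreeOneModel
import Literature.AlgebraicGeometry.HodgeTheory.WeilClassesProductsOfFactors
import Literature.AlgebraicGeometry.HodgeTheory.WeilSurfaceCMSquareModel
import HarnessLib

/-!
# Ring 2 · AbelianAll (ab-weil-1, gen 8, part 1/3) — the discriminant class `det H` is MULTIPLICATIVE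
  under products of Weil-type data, on the carriers; the CM square `E₀ × E₀` has every class `[-s₁s₂]`

research route, not a corollary; conditional on HC_CM plus one named minimal statement.
Cell line: research route conditional on HC_CM; not a corollary; Q11.4-sentence-2 already refuted in dim ≥ 3.
`HC_CM` (`Theses.RankFourFaces.CMAbelianHodge`) does not occur in this file, and no case of the Hodge
conjecture is claimed or used: this part is (bi)linear algebra on the cohomology carriers of a product
`A × B` of complex abelian varieties. It is the first of three files proving the ANTI-VACUITY converse of
gen 7: gen 7 showed that a typed component `(n, d, δ)` of the Weil tower with `sign δ ≠ (-1)ⁿ` is EMPTY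
(`weilSign_eq_of_hasWeilDiscriminantNondeg`); gen 8 shows that every component with `sign δ = (-1)ⁿ` is
INHABITED (part 3, `Ring2AbelianAllWeilCellsInhabited`), so that the open cells of the atlas are exactly
the right-sign classes and none of them is a statement about the empty set.

Multiplicativity `det H(A × B) = det H_A · det H_B` in `ℚˣ/Nm(Kˣ)` is NOT stated in van Geemen (LNM 1594): Lemma 5.2
(2)–(3) [p. 220] DEFINES `det H` and proves only its `K`-basis / lattice (isogeny) independence. It is elementary from
that (block-diagonal Gram matrices) and is PROVED HERE on the carriers; the one printed sentence asserting it is Markman,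
arXiv:2509.23403 §11.5 Step 2 (p. 19; preprint, no proof) — provenance only, nothing imported (referee F-ab-42). Here:
* §1 `det_weilGramMatrix_reindex_fromBlocks_smul` — the Gram matrix `a + b√-d` of a re-indexed block sum
  `(c_A a_A ⊕ c_B a_B, c_A b_A ⊕ c_B b_B)` has determinant `c_A^{k_A} c_B^{k_B} det Ψ_A det Ψ_B`;
* §2 `polarizationPairingOne_sumElim₂` — the block Gram matrix of `pr_A^* h_A + pr_B^* h_B` between the pulled-back
  frame `pr_A^* u ⊔ pr_B^* w` and a SECOND pulled-back frame `pr_A^* u' ⊔ pr_B^* w'` (`u' = u`, `w' = w` is the tree's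
  `Motives.polarizationPairingOne_sumElim`; same four block identities of `Motives/PolarizationPairingProduct`);
* §3 `hasWeilDiscriminantNondeg_prod` — MULTIPLICATIVITY: non-degenerate witnesses of classes `δ_A` for
  `(A, φ, n_A, d, h_A)` and `δ_B` for `(B, ψ, n_B, d, h_B)`, `h_A`, `h_B` rational of non-zero top power, give one of
  class `δ_A · δ_B` for `(A × B, φ × ψ, n_A + n_B, d, pr_A^* h_A + pr_B^* h_B)`, of non-zero top power (diagonal
  blocks rescaled by `C(m, 2n_A - 1)·d_B`, `C(m, 2n_A)·d_A`, `d_• = h_•^{2n_•}/ω_•`; even powers are norms);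
* §4 `hasWeilDiscriminantNondeg_cmSquare` — the BASE: for a CM elliptic curve `(E₀, ψ₀)`, `ψ₀² = -d`, rational
  `η ≠ 0`, `s₁, s₂ ≠ 0`: `(E₀ × E₀, ψ₀ × (-ψ₀), pr₁^*(s₁η) + pr₂^*(s₂η))` has a witness of class `[-s₁s₂]`, square `≠ 0`.

## References
* B. van Geemen, *An introduction to the Hodge conjecture for abelian varieties*, LNM 1594 (1994), 4.9,
  4.14, Lemma 5.2 (2)–(3), 5.3. [vanGeemen1994HodgeAV]
* Lange–Birkenhake (1992), Lemma 1.1.17, §5.3 [LangeBirkenhake1992]; Hatcher (2002), §3.2 Thm. 3.16 [HatcherAT2002].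
* E. Markman, *Secant sheaves and Weil classes …*, arXiv:2509.23403, §11.5 Step 2 (preprint). [Markman2025SurveySecant]
-/

noncomputable section

set_option linter.dupNamespace false

open CategoryTheory Polynomial
open Literature.AlgebraicGeometry Literature.AlgebraicGeometry.Motives
open Literature.AlgebraicGeometry.HodgeTheory
open Literature.AlgebraicGeometry.VanGeemen1994
open Literature.AlgebraicTopology.SingularHomology
open Literature.Geometry.Kaehler
open Summit.HodgeConjecture.HodgeConjecture.Ring2.Hypotheses

namespace Summit.HodgeConjecture.HodgeConjecture.Ring2.AbelianAll

/-! ### §1 Block Gram matrices -/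

/-- The Gram matrix `a + b√-d` of a re-indexed block-diagonal pair is the re-indexed block-diagonal of the
Gram matrices. [cite: vanGeemen1994HodgeAV, Lemma 5.2 (2)–(3)] -/
theorem weilGramMatrix_reindex_fromBlocks (d : ℕ) {kA kB N : ℕ} (e : Fin kA ⊕ Fin kB ≃ Fin N)
    (aA bA : Matrix (Fin kA) (Fin kA) ℚ) (aB bB : Matrix (Fin kB) (Fin kB) ℚ) :
    weilGramMatrix d (Matrix.reindex e e (Matrix.fromBlocks aA 0 0 aB))
        (Matrix.reindex e e (Matrix.fromBlocks bA 0 0 bB)) =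
      Matrix.reindex e e (Matrix.fromBlocks (weilGramMatrix d aA bA) 0 0 (weilGramMatrix d aB bB)) := by
  ext s t
  obtain ⟨s, rfl⟩ := e.surjective s
  obtain ⟨t, rfl⟩ := e.surjective t
  simp only [Matrix.reindex_apply, Matrix.submatrix_apply, Equiv.symm_apply_apply, weilGramMatrix_apply]
  rcases s with i | k <;> rcases t with j | l <;>
    simp [Matrix.fromBlocks_apply₁₁, Matrix.fromBlocks_apply₁₂, Matrix.fromBlocks_apply₂₁,
      Matrix.fromBlocks_apply₂₂, weilGramMatrix_apply]

/-- **`det Ψ` of a rescaled block sum**: `det Ψ(c_A a_A ⊕ c_B a_B, c_A b_A ⊕ c_B b_B) =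
c_A^{k_A} c_B^{k_B} · det Ψ(a_A, b_A) · det Ψ(a_B, b_B)` (our block formula; van Geemen 5.2 (2)–(3) only defines
`det Ψ`). [cite: vanGeemen1994HodgeAV, Lemma 5.2 (2)–(3) (definition of det Ψ)] -/
theorem det_weilGramMatrix_reindex_fromBlocks_smul (d : ℕ) {kA kB N : ℕ} (e : Fin kA ⊕ Fin kB ≃ Fin N)
    (cA cB : ℚ) (aA bA : Matrix (Fin kA) (Fin kA) ℚ) (aB bB : Matrix (Fin kB) (Fin kB) ℚ) :
    (weilGramMatrix d (Matrix.reindex e e (Matrix.fromBlocks (cA • aA) 0 0 (cB • aB)))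
        (Matrix.reindex e e (Matrix.fromBlocks (cA • bA) 0 0 (cB • bB)))).det =
      algebraMap ℚ (weilField d) (cA ^ kA * cB ^ kB) *
        ((weilGramMatrix d aA bA).det * (weilGramMatrix d aB bB).det) := by
  rw [weilGramMatrix_reindex_fromBlocks, Matrix.det_reindex_self, Matrix.det_fromBlocks_zero₂₁,
    det_weilGramMatrix_smul, det_weilGramMatrix_smul, map_mul]
  ring

/-- Re-indexing a frame `pr_A^* x_A ⊔ pr_B^* x_B` of `H¹((A × B)(ℂ))` together with a second frame
`pr_A^* x_A' ⊔ pr_B^* x_B'` preserves the linear independence of their union (Künneth in degree one,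
`Motives.linearIndependent_sumElim_map_fst_map_snd`, and a permutation of the index set).
[cite: HatcherAT2002, §3.2 Thm. 3.16] -/
theorem linearIndependent_sumElim_prodFrame {A B : AbelianVariety ℂ} {kA kB N : ℕ}
    (e : Fin kA ⊕ Fin kB ≃ Fin N) {xA xA' : Fin kA → complexBetti A.X 1} {xB xB' : Fin kB → complexBetti B.X 1}
    (hA : LinearIndependent ℂ (Sum.elim xA xA')) (hB : LinearIndependent ℂ (Sum.elim xB xB')) :
    LinearIndependent ℂ (Sum.elim
      (fun s => Sum.elim (fun i => complexBetti.map (AbelianVariety.fst A B).hom.hom.hom 1 (xA i))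
        (fun k => complexBetti.map (AbelianVariety.snd A B).hom.hom.hom 1 (xB k)) (e.symm s))
      (fun s => Sum.elim (fun i => complexBetti.map (AbelianVariety.fst A B).hom.hom.hom 1 (xA' i))
        (fun k => complexBetti.map (AbelianVariety.snd A B).hom.hom.hom 1 (xB' k)) (e.symm s))) := by
  have hV := linearIndependent_sumElim_map_fst_map_snd (A := A) (B := B) hA hB
  let σ : Fin N ⊕ Fin N ≃ (Fin kA ⊕ Fin kA) ⊕ (Fin kB ⊕ Fin kB) :=
    (e.symm.sumCongr e.symm).trans (Equiv.sumSumSumComm _ _ _ _)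
  convert hV.comp σ σ.injective using 1
  funext x
  rcases x with s | s <;>
  · simp only [Sum.elim_inl, Sum.elim_inr, Function.comp_apply, σ, Equiv.trans_apply, Equiv.sumCongr_apply,
      Sum.map_inl, Sum.map_inr]
    generalize e.symm s = y
    rcases y with i | k <;> simp [Equiv.sumSumSumComm, Equiv.sumAssoc]

/-! ### §2 The block Gram matrix between two pulled-back frames -/

/-- **The block Gram matrix of `pr_A^* h_A + pr_B^* h_B` between two pulled-back frames**: with respect to
`ω = pr_A^* ω_A ⌣ pr_B^* ω_B` and exponent `m = j_A + j_B + 1` (`dim A = j_A + 1`, `dim B = j_B + 1`), the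
pairing of `pr_A^* u ⊔ pr_B^* w` with `pr_A^* u' ⊔ pr_B^* w'` has matrix
`C(m, j_A)·d_B·G_A ⊕ C(m, j_A + 1)·d_A·G_B`, where `G_A`, `G_B` are the factor Gram matrices of `(u, u')`,
`(w, w')` and `d_• = h_•^{j_• + 1}/ω_•` (the case `u' = u`, `w' = w` is the tree's
`Motives.polarizationPairingOne_sumElim`). [cite: vanGeemen1994HodgeAV, Lemma 5.2 (2)–(3)] -/
theorem polarizationPairingOne_sumElim₂ {A B : AbelianVariety ℂ} {jA jB : ℕ} (hAdim : A.dim = jA + 1)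
    (hBdim : B.dim = jB + 1) {m : ℕ} (hm : m = jA + jB + 1) {ιA ιB : Type}
    (u u' : ιA → complexBetti A.X 1) (w w' : ιB → complexBetti B.X 1)
    (hA2 : complexBetti A.X 2) (ωA : complexBetti A.X (2 + 2 * jA)) (GA : Matrix ιA ιA ℚ)
    (hGA : ∀ i j, polarizationPairingOne A.X hA2 jA (u i) (u' j) = ((GA i j : ℚ) : ℂ) • ωA)
    (dA : ℚ) (hdA : lefschetzPow hA2 jA 2 hA2 = ((dA : ℚ) : ℂ) • ωA)
    (hB2 : complexBetti B.X 2) (ωB : complexBetti B.X (2 + 2 * jB)) (GB : Matrix ιB ιB ℚ)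
    (hGB : ∀ k l, polarizationPairingOne B.X hB2 jB (w k) (w' l) = ((GB k l : ℚ) : ℂ) • ωB)
    (dB : ℚ) (hdB : lefschetzPow hB2 jB 2 hB2 = ((dB : ℚ) : ℂ) • ωB) (s t : ιA ⊕ ιB) :
    polarizationPairingOne (A.prod B).X
        (complexBetti.map (AbelianVariety.fst A B).hom.hom.hom 2 hA2 +
          complexBetti.map (AbelianVariety.snd A B).hom.hom.hom 2 hB2) m
        (Sum.elim (fun i => complexBetti.map (AbelianVariety.fst A B).hom.hom.hom 1 (u i))
          (fun k => complexBetti.map (AbelianVariety.snd A B).hom.hom.hom 1 (w k)) s)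
        (Sum.elim (fun i => complexBetti.map (AbelianVariety.fst A B).hom.hom.hom 1 (u' i))
          (fun k => complexBetti.map (AbelianVariety.snd A B).hom.hom.hom 1 (w' k)) t) =
      ((Matrix.fromBlocks (((m.choose jA : ℚ) * dB) • GA) 0 0 (((m.choose (jA + 1) : ℚ) * dA) • GB) s t
          : ℚ) : ℂ) •
        cupProduct (by omega : (2 + 2 * jA) + (2 + 2 * jB) = 2 + 2 * m)
          (complexBetti.map (AbelianVariety.fst A B).hom.hom.hom (2 + 2 * jA) ωA)
          (complexBetti.map (AbelianVariety.snd A B).hom.hom.hom (2 + 2 * jB) ωB) := by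
  have hX : IsSmoothProjective (jA + 1) A.X := isSmoothProjective_of_dim_eq' hAdim
  have hY : IsSmoothProjective (jB + 1) B.X := isSmoothProjective_of_dim_eq' hBdim
  rcases s with i | k <;> rcases t with j | l
  · simp only [Sum.elim_inl, Matrix.fromBlocks_apply₁₁, Matrix.smul_apply, smul_eq_mul]
    rw [polarizationPairingOne_add_map_map _ _ hX hY hA2 hB2 hm, hGA, hdB]
    simp only [map_smul, LinearMap.smul_apply, smul_smul]
    congr 1
    push_cast
    ring
  · simp only [Sum.elim_inl, Sum.elim_inr, Matrix.fromBlocks_apply₁₂, Matrix.zero_apply,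
      Rat.cast_zero, zero_smul]
    exact polarizationPairingOne_add_map_map_mixed _ _ hX hY hA2 hB2 hm (u i) (w' l)
  · simp only [Sum.elim_inl, Sum.elim_inr, Matrix.fromBlocks_apply₂₁, Matrix.zero_apply,
      Rat.cast_zero, zero_smul]
    exact polarizationPairingOne_add_map_map_mixed' _ _ hX hY hA2 hB2 hm (u' j) (w k)
  · simp only [Sum.elim_inr, Matrix.fromBlocks_apply₂₂, Matrix.smul_apply, smul_eq_mul]
    rw [polarizationPairingOne_add_map_map' _ _ hX hY hA2 hB2 hm, hGB, hdA]
    simp only [map_smul, LinearMap.smul_apply, smul_smul]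
    congr 1
    push_cast
    ring

/-! ### §3 Multiplicativity of the discriminant class under products -/

/-- **`det H` is multiplicative under products** (on the carriers; elementary from the basis-independence of
van Geemen Lemma 5.2 (3) but NOT stated in [vG94]; the printed sentence is Markman arXiv:2509.23403 §11.5 Step 2,
unrefereed, no proof — nothing imported). Let
`(A, φ)` and `(B, ψ)` be complex abelian varieties of dimensions `2n_A`, `2n_B` (`n_A, n_B ≥ 1`) with
rational classes `h_A`, `h_B` of NON-ZERO top powers `h_A^{2n_A}`, `h_B^{2n_B}`, carrying non-degenerate
discriminant witnesses of classes `δ_A`, `δ_B ∈ ℚˣ/Nm(K_dˣ)`. Then `(A × B, φ × ψ, pr_A^* h_A + pr_B^* h_B)`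
carries a non-degenerate witness of class `δ_A · δ_B` (in the frame `pr_A^* x_A ⊔ pr_B^* x_B` with the
reference class `pr_A^* ω_A ⌣ pr_B^* ω_B` the matrices `a`, `b` are the block sums of those of the factors
rescaled by `C(m, 2n_A - 1)·d_B` and `C(m, 2n_A)·d_A`, whose `2n_A`-th and `2n_B`-th powers are norms), and
the top power of `pr_A^* h_A + pr_B^* h_B` is again non-zero (`= C(2n_A + 2n_B, 2n_A)·d_A·d_B · ω`).
[cite: vanGeemen1994HodgeAV, Lemma 5.2 (2)–(3) (definition of det H)] [cite: Markman2025SurveySecant, §11.5 Step 2 (p. 19)] -/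
theorem hasWeilDiscriminantNondeg_prod {A B : AbelianVariety ℂ} {φ : A ⟶ A} {ψ : B ⟶ B} {nA nB d : ℕ}
    (hnA : 0 < nA) (hnB : 0 < nB) (hA : A.dim = 2 * nA) (hB : B.dim = 2 * nB)
    {hA2 : complexBetti A.X 2} {hB2 : complexBetti B.X 2} (hrA : IsRationalClass hA2)
    (hrB : IsRationalClass hB2) (htA : lefschetzPow hA2 (2 * nA - 1) 2 hA2 ≠ 0)
    (htB : lefschetzPow hB2 (2 * nB - 1) 2 hB2 ≠ 0) {δA δB : weilNormResidueGroup d}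
    (hWA : HasWeilDiscriminantNondeg A φ nA d hA2 δA) (hWB : HasWeilDiscriminantNondeg B ψ nB d hB2 δB) :
    HasWeilDiscriminantNondeg (A.prod B)
        (AbelianVariety.prodLift (AbelianVariety.fst A B ≫ φ) (AbelianVariety.snd A B ≫ ψ)) (nA + nB) d
        (complexBetti.map (AbelianVariety.fst A B).hom.hom.hom 2 hA2 +
          complexBetti.map (AbelianVariety.snd A B).hom.hom.hom 2 hB2) (δA * δB) ∧
      lefschetzPow (complexBetti.map (AbelianVariety.fst A B).hom.hom.hom 2 hA2 +
          complexBetti.map (AbelianVariety.snd A B).hom.hom.hom 2 hB2) (2 * (nA + nB) - 1) 2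
        (complexBetti.map (AbelianVariety.fst A B).hom.hom.hom 2 hA2 +
          complexBetti.map (AbelianVariety.snd A B).hom.hom.hom 2 hB2) ≠ 0 := by
  classical
  obtain ⟨xA, ωA, aA, bA, qA, hxA, hliA, hωA, hωA0, hQA, hdetA, hclA⟩ := hWA
  obtain ⟨xB, ωB, aB, bB, qB, hxB, hliB, hωB, hωB0, hQB, hdetB, hclB⟩ := hWB
  -- dimensions: `dim A = j_A + 1`, `dim B = j_B + 1`, `m = j_A + j_B + 1`
  have hAdim : A.dim = 2 * nA - 1 + 1 := by omega
  have hBdim : B.dim = 2 * nB - 1 + 1 := by omega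
  have hm : 2 * (nA + nB) - 1 = (2 * nA - 1) + (2 * nB - 1) + 1 := by omega
  have hX : IsSmoothProjective (2 * nA - 1 + 1) A.X := isSmoothProjective_of_dim_eq' hAdim
  have hY : IsSmoothProjective (2 * nB - 1 + 1) B.X := isSmoothProjective_of_dim_eq' hBdim
  -- the top powers `h^{2n} = d_• ω_•`, `d_• ∈ ℚˣ`
  obtain ⟨dA, hdA⟩ := exists_eq_ratCast_smul_of_finrank_eq_one
    (Motives.finrank_complexBetti_two_add_two_mul_eq_one hX)
    hωA hωA0 (HodgeRiemannDegreeOne.IsRationalClass.lefschetzPow hrA (2 * nA - 1) hrA)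
  obtain ⟨dB, hdB⟩ := exists_eq_ratCast_smul_of_finrank_eq_one
    (Motives.finrank_complexBetti_two_add_two_mul_eq_one hY)
    hωB hωB0 (HodgeRiemannDegreeOne.IsRationalClass.lefschetzPow hrB (2 * nB - 1) hrB)
  have hdA0 : dA ≠ 0 := by rintro rfl; exact htA (by rw [hdA, Rat.cast_zero, zero_smul])
  have hdB0 : dB ≠ 0 := by rintro rfl; exact htB (by rw [hdB, Rat.cast_zero, zero_smul])
  have hcA : ((2 * (nA + nB) - 1).choose (2 * nA - 1) : ℚ) * dB ≠ 0 :=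
    mul_ne_zero (Nat.cast_ne_zero.2 (Nat.choose_pos (by omega)).ne') hdB0
  have hcB : ((2 * (nA + nB) - 1).choose (2 * nA - 1 + 1) : ℚ) * dA ≠ 0 :=
    mul_ne_zero (Nat.cast_ne_zero.2 (Nat.choose_pos (by omega)).ne') hdA0
  -- the frames `pr_A^* x_A ⊔ pr_B^* x_B`, `pr_A^* φ^* x_A ⊔ pr_B^* ψ^* x_B`, re-indexed by `Fin (2(n_A + n_B))`
  let e : Fin (2 * nA) ⊕ Fin (2 * nB) ≃ Fin (2 * (nA + nB)) := finSumFinEquiv.trans (finCongr (by ring))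
  let U : Fin (2 * nA) ⊕ Fin (2 * nB) → complexBetti (A.prod B).X 1 :=
    Sum.elim (fun i => complexBetti.map (AbelianVariety.fst A B).hom.hom.hom 1 (xA i))
      (fun k => complexBetti.map (AbelianVariety.snd A B).hom.hom.hom 1 (xB k))
  let U' : Fin (2 * nA) ⊕ Fin (2 * nB) → complexBetti (A.prod B).X 1 :=
    Sum.elim (fun i => complexBetti.map (AbelianVariety.fst A B).hom.hom.hom 1
        (complexBetti.map φ.hom.hom.hom 1 (xA i)))
      (fun k => complexBetti.map (AbelianVariety.snd A B).hom.hom.hom 1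
        (complexBetti.map ψ.hom.hom.hom 1 (xB k)))
  have hΦU : ∀ s, complexBetti.map (AbelianVariety.prodLift (AbelianVariety.fst A B ≫ φ)
      (AbelianVariety.snd A B ≫ ψ)).hom.hom.hom 1 (U s) = U' s := by
    rintro (i | k)
    exacts [map_prodLift_map_fst φ ψ 1 (xA i), map_prodLift_map_snd φ ψ 1 (xB k)]
  -- the reference top class `pr_A^* ω_A ⌣ pr_B^* ω_B`
  have hω0 : cupProduct (by omega : (2 + 2 * (2 * nA - 1)) + (2 + 2 * (2 * nB - 1)) = 2 + 2 * (2 * (nA + nB) - 1))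
      (complexBetti.map (AbelianVariety.fst A B).hom.hom.hom (2 + 2 * (2 * nA - 1)) ωA)
      (complexBetti.map (AbelianVariety.snd A B).hom.hom.hom (2 + 2 * (2 * nB - 1)) ωB) ≠ 0 :=
    cupProduct_map_fst_map_snd_ne_zero_of_add_eq hX hY _ (by omega) hωA0 hωB0
  refine ⟨⟨fun s => U (e.symm s), _,
    Matrix.reindex e e (Matrix.fromBlocks ((((2 * (nA + nB) - 1).choose (2 * nA - 1) : ℚ) * dB) • aA) 0 0
      ((((2 * (nA + nB) - 1).choose (2 * nA - 1 + 1) : ℚ) * dA) • aB)),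
    Matrix.reindex e e (Matrix.fromBlocks ((((2 * (nA + nB) - 1).choose (2 * nA - 1) : ℚ) * dB) • bA) 0 0
      ((((2 * (nA + nB) - 1).choose (2 * nA - 1 + 1) : ℚ) * dA) • bB)),
    Units.mk0 _ hcA ^ (2 * nA) * qA * (Units.mk0 _ hcB ^ (2 * nB) * qB), ?_, ?_, (hωA.map _).cup _ (hωB.map _),
    hω0, ?_, ?_, ?_⟩, ?_⟩
  · -- rationality of the frame
    intro s
    show IsRationalClass (U (e.symm s))
    generalize e.symm s = y
    rcases y with i | k
    exacts [(hxA i).map _, (hxB k).map _]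
  · -- independence of the frame and its `(φ × ψ)^*`-translates (Künneth in degree one)
    have hfun : (fun s => complexBetti.map (AbelianVariety.prodLift (AbelianVariety.fst A B ≫ φ)
        (AbelianVariety.snd A B ≫ ψ)).hom.hom.hom 1 (U (e.symm s))) = fun s => U' (e.symm s) :=
      funext fun s => hΦU _
    rw [hfun]
    exact linearIndependent_sumElim_prodFrame e hliA hliB
  · -- the block Gram matrices
    intro s t
    rw [hΦU]
    exact ⟨polarizationPairingOne_sumElim₂ hAdim hBdim hm xA _ xB _ hA2 ωA aA (fun i j => (hQA i j).1) dA hdA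
        hB2 ωB aB (fun k l => (hQB k l).1) dB hdB (e.symm s) (e.symm t),
      polarizationPairingOne_sumElim₂ hAdim hBdim hm xA xA xB xB hA2 ωA bA (fun i j => (hQA i j).2) dA hdA
        hB2 ωB bB (fun k l => (hQB k l).2) dB hdB (e.symm s) (e.symm t)⟩
  · -- `det Ψ = c_A^{2n_A} c_B^{2n_B} det Ψ_A det Ψ_B`
    rw [det_weilGramMatrix_reindex_fromBlocks_smul, hdetA, hdetB, ← map_mul, ← map_mul]
    congr 1
    simp only [Units.val_mul, Units.val_pow_eq_pow_val, Units.val_mk0]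
    ring
  · -- the class: even powers are norms
    rw [QuotientGroup.mk_mul, mk_pow_two_mul_pow_mul, mk_pow_two_mul_pow_mul, hclA, hclB]
  · -- the top power of the product class
    rw [lefschetzPow_add_map_self hAdim hBdim hm hA2 ωA dA hdA hB2 ωB dB hdB]
    refine smul_ne_zero ?_ hω0
    exact_mod_cast mul_ne_zero (mul_ne_zero (Nat.cast_ne_zero.2 (Nat.choose_pos (by omega)).ne') hdA0) hdB0

/-! ### §4 The CM square `(E₀ × E₀, ψ₀ × (-ψ₀))` with the class `pr₁^*(s₁η) + pr₂^*(s₂η)` -/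

/-- **The discriminant classes of the CM square** (van Geemen 5.3 on the carriers). For a complex elliptic
curve `E₀` with `ψ₀ ≫ ψ₀ = -(d • 𝟙)`, `d ≥ 1`, a non-zero rational `η ∈ H²(E₀(ℂ); ℂ)` and rational weights
`s₁, s₂ ≠ 0`, the abelian surface `(E₀ × E₀, ψ₀ × (-ψ₀))` with the class `pr₁^*(s₁η) + pr₂^*(s₂η)` has a
NON-DEGENERATE discriminant witness of class `[-s₁s₂] ∈ ℚˣ/Nm(K_dˣ)`: in the frame `(pr₁^* v, pr₂^* v)`
(`(v, ψ₀^*v)` the rational frame of `H¹(E₀)`, `η = tω_E`, `ω_E = v ∪ ψ₀^*v`) one has `b = 0` and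
`a = diag(s₂t, -s₁t)`, `det Ψ = -s₁s₂t²`; and `(pr₁^*(s₁η) + pr₂^*(s₂η))² = 2s₁s₂t² · pr₁^*ω_E ⌣ pr₂^*ω_E ≠ 0`.
[cite: vanGeemen1994HodgeAV, 5.3 and Lemma 5.2 (2)–(3)] -/
theorem hasWeilDiscriminantNondeg_cmSquare {E₀ : AbelianVariety ℂ} {ψ₀ : E₀ ⟶ E₀} {d : ℕ} (hE : E₀.dim = 1)
    (hd : 0 < d) (hψ : ψ₀ ≫ ψ₀ = -(d • 𝟙 E₀)) {η : complexBetti E₀.X 2} (hη : IsRationalClass η)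
    (hη0 : η ≠ 0) {s₁ s₂ : ℚ} (hs₁ : s₁ ≠ 0) (hs₂ : s₂ ≠ 0) :
    HasWeilDiscriminantNondeg (E₀.prod E₀)
        (AbelianVariety.prodLift (AbelianVariety.fst E₀ E₀ ≫ ψ₀) (AbelianVariety.snd E₀ E₀ ≫ (-ψ₀))) 1 d
        (complexBetti.map (AbelianVariety.fst E₀ E₀).hom.hom.hom 2 (((s₁ : ℚ) : ℂ) • η) +
          complexBetti.map (AbelianVariety.snd E₀ E₀).hom.hom.hom 2 (((s₂ : ℚ) : ℂ) • η))
        (QuotientGroup.mk (-(Units.mk0 s₁ hs₁ * Units.mk0 s₂ hs₂))) ∧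
      lefschetzPow (complexBetti.map (AbelianVariety.fst E₀ E₀).hom.hom.hom 2 (((s₁ : ℚ) : ℂ) • η) +
          complexBetti.map (AbelianVariety.snd E₀ E₀).hom.hom.hom 2 (((s₂ : ℚ) : ℂ) • η)) (2 * 1 - 1) 2
        (complexBetti.map (AbelianVariety.fst E₀ E₀).hom.hom.hom 2 (((s₁ : ℚ) : ℂ) • η) +
          complexBetti.map (AbelianVariety.snd E₀ E₀).hom.hom.hom 2 (((s₂ : ℚ) : ℂ) • η)) ≠ 0 := by
  classical
  obtain ⟨u, ωE, hur, hli, -, hMu, hMu', hωEr, hωE0, hG, -, -, -⟩ := cmCurve_rationalModel hE hd hψ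
  have hE' : E₀.dim = 0 + 1 := by rw [hE]
  have hX : IsSmoothProjective (0 + 1) E₀.X := isSmoothProjective_of_dim_eq' hE'
  have hm : 2 * 1 - 1 = 0 + 0 + 1 := by norm_num
  -- `η = t ω_E`, `t ∈ ℚˣ`
  obtain ⟨t, ht⟩ := exists_eq_ratCast_smul_of_finrank_eq_one
    (Motives.finrank_complexBetti_two_add_two_mul_eq_one hX) hωEr hωE0 hη
  have ht0 : t ≠ 0 := by rintro rfl; exact hη0 (by rw [ht, Rat.cast_zero, zero_smul])
  -- `ψ₀^* u₀ = u₁`, `(-ψ₀)^* u₀ = -u₁`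
  have hu0 : complexBetti.map ψ₀.hom.hom.hom 1 (u 0) = u 1 := by
    rw [hMu 0]; simp [Fin.sum_univ_two]
  have hu0' : complexBetti.map (-ψ₀).hom.hom.hom 1 (u 0) = -u 1 := by
    rw [hMu' 0]; simp [Fin.sum_univ_two]
  -- the curve pairings `Q_h(u₀, u₁) = ω_E`, `Q_h(u₀, -u₁) = -ω_E`, `Q_h(u₀, u₀) = 0`, for every `h`
  have hQ01 : ∀ (h : complexBetti E₀.X 2) (i j : Fin 1),
      polarizationPairingOne E₀.X h 0 (u 0) (u 1) = ((!![(1 : ℚ)] i j : ℚ) : ℂ) • ωE := fun h i j => by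
    fin_cases i; fin_cases j; rw [hG h 0 1]; simp
  have hQ01' : ∀ (h : complexBetti E₀.X 2) (i j : Fin 1),
      polarizationPairingOne E₀.X h 0 (u 0) (-u 1) = ((!![(-1 : ℚ)] i j : ℚ) : ℂ) • ωE := fun h i j => by
    fin_cases i; fin_cases j; rw [map_neg, hG h 0 1]; simp
  have hQ00 : ∀ (h : complexBetti E₀.X 2) (i j : Fin 1),
      polarizationPairingOne E₀.X h 0 (u 0) (u 0) = ((!![(0 : ℚ)] i j : ℚ) : ℂ) • ωE := fun h i j => by
    fin_cases i; fin_cases j; rw [hG h 0 0]; simp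
  -- `L⁰_{sη}(sη) = sη = (st) ω_E`
  have htop : ∀ s : ℚ, lefschetzPow (((s : ℚ) : ℂ) • η) 0 2 (((s : ℚ) : ℂ) • η) = (((s * t : ℚ) : ℚ) : ℂ) • ωE := by
    intro s
    rw [lefschetzPow_zero, LinearMap.id_apply, ht, smul_smul, ← Rat.cast_mul]
  -- the factor frames `(u₀ | u₁)` and `(u₀ | -u₁)` are independent
  have hliA : LinearIndependent ℂ (Sum.elim (fun _ : Fin 1 => u 0) (fun _ : Fin 1 => u 1)) := by
    have h := hli.comp (finSumFinEquiv : Fin 1 ⊕ Fin 1 ≃ Fin 2) (finSumFinEquiv : Fin 1 ⊕ Fin 1 ≃ Fin 2).injective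
    convert h using 1
    funext x
    rcases x with i | i <;>
    · fin_cases i
      rfl
  have hliB : LinearIndependent ℂ (Sum.elim (fun _ : Fin 1 => u 0) (fun _ : Fin 1 => -u 1)) := by
    have h := (linearIndependent_sum_elim_smul_iff (fun _ : Fin 1 => u 0) (fun _ : Fin 1 => u 1)
      (c := (-1 : ℂ)) (by norm_num)).2 hliA
    simpa using h
  -- the frame `(pr₁^* u₀, pr₂^* u₀)` of the square, and its `(ψ₀ × (-ψ₀))^*`-translates
  let e : Fin 1 ⊕ Fin 1 ≃ Fin (2 * 1) := finSumFinEquiv.trans (finCongr (by norm_num))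
  let U : Fin 1 ⊕ Fin 1 → complexBetti (E₀.prod E₀).X 1 :=
    Sum.elim (fun _ => complexBetti.map (AbelianVariety.fst E₀ E₀).hom.hom.hom 1 (u 0))
      (fun _ => complexBetti.map (AbelianVariety.snd E₀ E₀).hom.hom.hom 1 (u 0))
  let U' : Fin 1 ⊕ Fin 1 → complexBetti (E₀.prod E₀).X 1 :=
    Sum.elim (fun _ => complexBetti.map (AbelianVariety.fst E₀ E₀).hom.hom.hom 1 (u 1))
      (fun _ => complexBetti.map (AbelianVariety.snd E₀ E₀).hom.hom.hom 1 (-u 1))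
  have hΦU : ∀ s, complexBetti.map (AbelianVariety.prodLift (AbelianVariety.fst E₀ E₀ ≫ ψ₀)
      (AbelianVariety.snd E₀ E₀ ≫ (-ψ₀))).hom.hom.hom 1 (U s) = U' s := by
    rintro (i | k)
    · show _ = complexBetti.map (AbelianVariety.fst E₀ E₀).hom.hom.hom 1 (u 1)
      rw [← hu0]
      exact map_prodLift_map_fst ψ₀ (-ψ₀) 1 (u 0)
    · show _ = complexBetti.map (AbelianVariety.snd E₀ E₀).hom.hom.hom 1 (-u 1)
      rw [← hu0']
      exact map_prodLift_map_snd ψ₀ (-ψ₀) 1 (u 0)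
  have hω0 : cupProduct (by norm_num : (2 + 2 * 0) + (2 + 2 * 0) = 2 + 2 * (2 * 1 - 1))
      (complexBetti.map (AbelianVariety.fst E₀ E₀).hom.hom.hom (2 + 2 * 0) ωE)
      (complexBetti.map (AbelianVariety.snd E₀ E₀).hom.hom.hom (2 + 2 * 0) ωE) ≠ 0 :=
    cupProduct_map_fst_map_snd_ne_zero_of_add_eq hX hX _ (by norm_num) hωE0 hωE0
  refine ⟨⟨fun s => U (e.symm s), _,
      Matrix.reindex e e (Matrix.fromBlocks ((((2 * 1 - 1).choose 0 : ℚ) * (s₂ * t)) • !![(1 : ℚ)]) 0 0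
        ((((2 * 1 - 1).choose (0 + 1) : ℚ) * (s₁ * t)) • !![(-1 : ℚ)])),
      Matrix.reindex e e (Matrix.fromBlocks ((((2 * 1 - 1).choose 0 : ℚ) * (s₂ * t)) • !![(0 : ℚ)]) 0 0
        ((((2 * 1 - 1).choose (0 + 1) : ℚ) * (s₁ * t)) • !![(0 : ℚ)])),
      Units.mk0 t ht0 ^ (2 * 1) * -(Units.mk0 s₁ hs₁ * Units.mk0 s₂ hs₂), ?_, ?_,
      (hωEr.map _).cup _ (hωEr.map _), hω0, ?_, ?_, mk_pow_two_mul_pow_mul d _ _ 1⟩, ?_⟩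
  · -- rationality
    intro s
    show IsRationalClass (U (e.symm s))
    generalize e.symm s = y
    rcases y with i | k <;> exact (hur 0).map _
  · -- independence
    have hfun : (fun s => complexBetti.map (AbelianVariety.prodLift (AbelianVariety.fst E₀ E₀ ≫ ψ₀)
        (AbelianVariety.snd E₀ E₀ ≫ (-ψ₀))).hom.hom.hom 1 (U (e.symm s))) = fun s => U' (e.symm s) :=
      funext fun s => hΦU _
    rw [hfun]
    exact linearIndependent_sumElim_prodFrame e hliA hliB
  · -- the Gram matrices `a = diag(s₂t, -s₁t)`, `b = 0`
    intro s s'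
    rw [hΦU]
    exact ⟨polarizationPairingOne_sumElim₂ hE' hE' hm (fun _ => u 0) (fun _ => u 1) (fun _ => u 0) (fun _ => -u 1)
        _ ωE !![(1 : ℚ)] (hQ01 _) (s₁ * t) (htop s₁) _ ωE !![(-1 : ℚ)] (hQ01' _) (s₂ * t) (htop s₂)
        (e.symm s) (e.symm s'),
      polarizationPairingOne_sumElim₂ hE' hE' hm (fun _ => u 0) (fun _ => u 0) (fun _ => u 0) (fun _ => u 0)
        _ ωE !![(0 : ℚ)] (hQ00 _) (s₁ * t) (htop s₁) _ ωE !![(0 : ℚ)] (hQ00 _) (s₂ * t) (htop s₂)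
        (e.symm s) (e.symm s')⟩
  · -- `det Ψ = -s₁s₂t²`
    rw [det_weilGramMatrix_reindex_fromBlocks_smul]
    have h1 : (weilGramMatrix d !![(1 : ℚ)] !![(0 : ℚ)]).det = algebraMap ℚ (weilField d) 1 := by
      simp [weilGramMatrix_apply]
    have h2 : (weilGramMatrix d !![(-1 : ℚ)] !![(0 : ℚ)]).det = algebraMap ℚ (weilField d) (-1) := by
      simp [weilGramMatrix_apply]
    rw [h1, h2, ← map_mul, ← map_mul]
    congr 1
    simp only [Units.val_mul, Units.val_neg, Units.val_pow_eq_pow_val, Units.val_mk0, Nat.reduceMul,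
      Nat.reduceSub, Nat.reduceAdd, Nat.choose_zero_right, Nat.choose_self, Nat.cast_one, one_mul]
    ring
  · -- the top power `2 s₁ s₂ t² ω`
    rw [lefschetzPow_add_map_self hE' hE' hm _ ωE (s₁ * t) (htop s₁) _ ωE (s₂ * t) (htop s₂)]
    refine smul_ne_zero ?_ hω0
    exact_mod_cast mul_ne_zero (mul_ne_zero (Nat.cast_ne_zero.2 (Nat.choose_pos (by norm_num)).ne')
      (mul_ne_zero hs₁ ht0)) (mul_ne_zero hs₂ ht0)

end Summit.HodgeConjecture.HodgeConjecture.Ring2.AbelianAll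

end
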